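import Summits.AtomisticToContinuum.FouriersLaw.Theorems.PhononMeanFreePathIncoherentChannelHarmonicForecast
import Summits.AtomisticToContinuum.FouriersLaw.Theorems.PhononMeanFreePathIncoherentChannelHarmonicFlowDriftComm
import Summits.AtomisticToContinuum.FouriersLaw.Theorems.PhononMeanFreePathIncoherentChannelHarmonicKineticMoment
import Summits.AtomisticToContinuum.FouriersLaw.Theorems.PhononMeanFreePathIncoherentChannelGibbsKoopmanDissipation

/-!
# `IncoherentChannel`, line `two-horizons-forecast-loss` — the EXACT dissipation identity of the forecast norm at the harmonic corner

Helper file (lead c6, cycle 1) for the ENGINE stub `stub_forecastLoss` of crux `PhononMeanFreePath.IncoherentChannel`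
(item stmt-AtomisticToContinuum-11811, route `PhononMeanFreePath`, sub-problem `FouriersLaw`), vocabulary of
`PhononMeanFreePathDefs`: `S_N(t) = fnorm … N t = ‖K_t p_N‖²_{L²(μ₀)}`, `r_N(t) = pairCorr … N t = ⟨p_0, K_t p_N⟩_{μ₀}`,
`a_N(t) = ⟨p_N, K_t p_N⟩_{μ₀}` (the echo), all for the `(N+1)`-site chain with both baths at `T`.

THE POINT. The line's weakest registered engine form is the ONE-TIME hypothesis `N·S_N(N^η) → 0` (p149873); the chain
"one-time ⇒ `CoherentDephasing`" runs through the tail budget `(2γ/T)∫_{t>t₁}(r_N² + a_N²) ≤ S_N(t₁)` (p148747), whose proof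
(Dynkin by truncation, p136614/p144914) needs `β > 0` and therefore says nothing at the harmonic corner `lam = β = 0` — the one
parameter point where the conclusion is KNOWN to fail (`HarmonicCoherentPersistence`). This file supplies the harmonic
dissipation theory EXACTLY, with equality: at `lam = β = 0`

* the forecast is the deterministic damped flow read on `p_N`, `v_t(z) = (Φ_t z)_{p_N}` (`harmonic_fcast_eq_freeFlow`, W-A),
  so `S_N(t) = ∫ ((Φ_t z)_{p_N})² dμ₀(z)` (`harmonic_fnorm_eq_integral_freeFlow`);
* **`dS_N/dt = -(2γ/T)·(r_N(t)² + a_N(t)²)` for `t > 0`** (`harmonic_fnorm_hasDerivAt`): the Koopman derivative along the free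
  flow (`harmonic_freeFlow_sqMomentum_hasDerivAt`, W-E), the commutation of the linear flow with its drift `Φ_t∘Y = Y∘Φ_t`
  (`harmonic_freeFlow_drift_comm`, W-B), the dissipation identity `∫ L·(L∘Y) dμ_T = -γT Σ_b w_b L(e_{p_b})²` for continuous
  linear `L` — antisymmetry of the Liouville operator in `L²(μ_T)` plus Stein in the momentum directions, NO Gibbs covariance and
  NO matrix exponential (`gibbs_clm_mul_clm_drift`, W-C) — and the classical fluctuation–dissipation relations
  `r_N = T·(Φ_t e_{p_0})_{p_N}`, `a_N = T·(Φ_t e_{p_N})_{p_N}` (W-A);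
* hence the HARMONIC TAIL IDENTITY `S_N(t₁) - S_N(t₂) = (2γ/T)∫_{t₁}^{t₂}(r_N² + a_N²)` (`harmonic_fnorm_sub_eq_integral`, FTC).

The registered closed form is `harmonic_fnorm_dissipation`. The tail budget, the LaSalle limit `S_N(t) → 0`, the exact forecast
sum rule `∫₀^∞(r_N² + a_N²) = T²/(2γ)` and the calibration `oneTime_false_harmonic` are in `…HarmonicTailBudget.lean`.
No definitions; nothing here closes an item.
-/

noncomputable section

namespace Summit.AtomisticToContinuum.FouriersLaw.Theorems.PhononMeanFreePath

open MeasureTheory Set Filter Topology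
open scoped NNReal
open Literature.MathematicalPhysics.KineticTheory.HeatConduction

/-! ### The free flow at clamped time -/

section FreeFlow

variable {ω₂ γ : ℝ} (hω : 0 < ω₂) (hγ : 0 ≤ γ)
include hω hγ

omit hω hγ in
/-- Clamping the time at `0⁺` does not change the free flow (it is clamped on `(-∞, 0]` anyway):
`Φ_{t⁺} z = Φ_t z`. [folklore] -/
theorem harmonic_freeFlow_toNNReal (n : ℕ) (z : PhaseSpace n) (t : ℝ) :
    (pinnedChain ω₂ 0 0 γ).chainFlow n z 0 (t.toNNReal : ℝ) = (pinnedChain ω₂ 0 0 γ).chainFlow n z 0 t := by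
  rcases le_or_gt 0 t with ht | ht
  · rw [Real.coe_toNNReal t ht]
  · rw [Real.toNNReal_of_nonpos ht.le, NNReal.coe_zero,
      pinnedChain_freeFlow_of_nonpos (ω₂ := ω₂) (lam := 0) (β := 0) (γ := γ) n z le_rfl,
      pinnedChain_freeFlow_of_nonpos (ω₂ := ω₂) (lam := 0) (β := 0) (γ := γ) n z ht.le]

/-- The free harmonic flow read on one momentum is a continuous linear functional of the initial
condition: `z ↦ (Φ_t z)_{p_i}`. [folklore] -/
theorem harmonic_exists_clm_freeFlow_snd (n : ℕ) (t : ℝ) (i : Fin n) :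
    ∃ L : PhaseSpace n →L[ℝ] ℝ, ∀ z, L z = ((pinnedChain ω₂ 0 0 γ).chainFlow n z 0 t).2 i := by
  obtain ⟨M, hM⟩ :=
    Summit.AtomisticToContinuum.FouriersLaw.Theorems.IncoherentChannel.Negative.HarmonicFlow.harmonic_chainFlow_zero_noise_linear
      hω hγ n t
  refine ⟨LinearMap.toContinuousLinearMap (((LinearMap.proj i).comp (LinearMap.snd ℝ _ _)).comp M), fun z => ?_⟩
  simp [hM z]

end FreeFlow

/-! ### The forecast norm at the harmonic corner and its exact dissipation identity -/

section Harmonic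

variable {ω₂ γ T : ℝ} (hω : 0 < ω₂) (hγ : 0 < γ) (hT : 0 < T)
include hω hγ hT

/-- **`S_N(t) = ∫ ((Φ_t z)_{p_N})² dμ₀(z)`**: at the harmonic corner the forecast norm is the Gibbs mean of the kinetic
observable `p_N²` transported by the DETERMINISTIC damped flow. [folklore] -/
theorem harmonic_fnorm_eq_integral_freeFlow (N : ℕ) (t : ℝ) :
    fnorm ω₂ 0 0 γ T N t =
      ∫ z, (((pinnedChain ω₂ 0 0 γ).chainFlow (N + 1) z 0 t).2 (Fin.last N)) ^ 2
        ∂((pinnedChain ω₂ 0 0 γ).gibbsMeasure (N + 1) T) := by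
  simp only [fnorm]
  refine integral_congr_ae (Eventually.of_forall fun z => ?_)
  simp only
  rw [harmonic_fcast_eq_freeFlow ω₂ γ hω hγ.le T hT N t z, harmonic_freeFlow_toNNReal (N + 1) z t]

/-- The right-hand impulse responses in the line's vocabulary: `r_N(t) = T·(Φ_t e_{p_0})_{p_N}` and
`a_N(t) = T·(Φ_t e_{p_N})_{p_N}` (classical fluctuation–dissipation at the harmonic corner). [folklore] -/
theorem harmonic_pairCorr_endAutocorr_eq (N : ℕ) (t : ℝ) :
    pairCorr ω₂ 0 0 γ T N t = T * ((pinnedChain ω₂ 0 0 γ).chainFlow (N + 1)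
        ((0, Pi.single 0 1) : PhaseSpace (N + 1)) 0 t).2 (Fin.last N) ∧
    ∫ z, z.2 (Fin.last N) * fcast ω₂ 0 0 γ T N t z ∂((pinnedChain ω₂ 0 0 γ).gibbsMeasure (N + 1) T) =
      T * ((pinnedChain ω₂ 0 0 γ).chainFlow (N + 1)
        ((0, Pi.single (Fin.last N) 1) : PhaseSpace (N + 1)) 0 t).2 (Fin.last N) := by
  constructor
  · rw [harmonic_pairCorr_eq_response ω₂ γ hω hγ.le T hT N t, harmonic_freeFlow_toNNReal]
  · rw [harmonic_endAutocorr_eq_response ω₂ γ hω hγ.le T hT N t, harmonic_freeFlow_toNNReal]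

omit hω hγ hT in
/-- Bath-weight bookkeeping on the `(N+1)`-site chain: `Σ_i w_i c_i² = c_0² + c_N²` (for `N = 0` both sides are `2c_0²`).
[folklore] -/
theorem sum_bathWeight_mul_sq (N : ℕ) (c : Fin (N + 1) → ℝ) :
    ∑ i : Fin (N + 1), OscillatorChain.bathWeight (N + 1) i * c i ^ 2 = c 0 ^ 2 + c (Fin.last N) ^ 2 := by
  simp only [OscillatorChain.bathWeight, Nat.add_sub_cancel, add_mul, Finset.sum_add_distrib, ite_mul, one_mul,
    zero_mul]
  have h1 : ∑ i : Fin (N + 1), (if i.val = 0 then c i ^ 2 else 0) = c 0 ^ 2 := by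
    rw [Finset.sum_eq_single_of_mem (0 : Fin (N + 1)) (Finset.mem_univ _)]
    · simp
    · intro b _ hb
      rw [if_neg]
      exact fun h => hb (Fin.ext h)
  have h2 : ∑ i : Fin (N + 1), (if i.val = N then c i ^ 2 else 0) = c (Fin.last N) ^ 2 := by
    rw [Finset.sum_eq_single_of_mem (Fin.last N) (Finset.mem_univ _)]
    · simp
    · intro b _ hb
      rw [if_neg]
      exact fun h => hb (Fin.ext (by simp [h]))
  rw [h1, h2]

/-- **THE EXACT DISSIPATION IDENTITY AT THE HARMONIC CORNER.** For the pinned harmonic chain (`ω₂, γ, T > 0`,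
both baths at `T`) and every `N`, the forecast norm `S_N(t) = ‖K_t p_N‖²_{L²(μ₀)}` is differentiable on `t > 0` with
`dS_N/dt = -(2γ/T)·(r_N(t)² + a_N(t)²)` — EQUALITY in the Bakry–Émery dissipation of the line's engine (the
general chain has only `≤`, p136614, and only for `β > 0`). Koopman derivative along the free flow (W-E), flow–drift
commutation (W-B), antisymmetry of the Liouville operator in `L²(μ₀)` plus Stein (W-C), fluctuation–dissipation (W-A);
no Gibbs covariance and no matrix exponential is used. [folklore] -/
theorem harmonic_fnorm_hasDerivAt (N : ℕ) {t : ℝ} (ht : 0 < t) :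
    HasDerivAt (fun s => fnorm ω₂ 0 0 γ T N s)
      (-(2 * γ / T) * ((pairCorr ω₂ 0 0 γ T N t) ^ 2 +
        (∫ z, z.2 (Fin.last N) * fcast ω₂ 0 0 γ T N t z ∂((pinnedChain ω₂ 0 0 γ).gibbsMeasure (N + 1) T)) ^ 2)) t := by
  set P := pinnedChain ω₂ 0 0 γ with hP
  set μ := P.gibbsMeasure (N + 1) T with hμ
  set ℓ : Fin (N + 1) := Fin.last N with hℓ
  -- the forecast norm IS the transported kinetic moment
  have hfun : (fun s => fnorm ω₂ 0 0 γ T N s) = fun s => ∫ z, ((P.chainFlow (N + 1) z 0 s).2 ℓ) ^ 2 ∂μ :=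
    funext fun s => harmonic_fnorm_eq_integral_freeFlow hω hγ hT N s
  rw [hfun]
  -- the Koopman derivative (W-E)
  have hD := (harmonic_freeFlow_sqMomentum_hasDerivAt ω₂ γ hω hγ T hT (N + 1) ℓ).2 t ht
  -- evaluate the derivative
  obtain ⟨L, hL⟩ := harmonic_exists_clm_freeFlow_snd hω hγ.le (N + 1) t ℓ
  have hcomm : ∀ z : PhaseSpace (N + 1), (P.drift (N + 1) (P.chainFlow (N + 1) z 0 t)).2 ℓ = L (P.drift (N + 1) z) := by
    intro z
    rw [hL, ← harmonic_freeFlow_drift_comm ω₂ γ hω hγ.le (N + 1) z t]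
  have hint : ∫ z, 2 * (P.chainFlow (N + 1) z 0 t).2 ℓ * (P.drift (N + 1) (P.chainFlow (N + 1) z 0 t)).2 ℓ ∂μ =
      -(2 * γ / T) * ((pairCorr ω₂ 0 0 γ T N t) ^ 2 +
        (∫ z, z.2 (Fin.last N) * fcast ω₂ 0 0 γ T N t z ∂((pinnedChain ω₂ 0 0 γ).gibbsMeasure (N + 1) T)) ^ 2) := by
    have e1 : (fun z => 2 * (P.chainFlow (N + 1) z 0 t).2 ℓ * (P.drift (N + 1) (P.chainFlow (N + 1) z 0 t)).2 ℓ) =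
        fun z => 2 * (L z * L (P.drift (N + 1) z)) := by
      funext z
      rw [hcomm z, ← hL z]
      ring
    rw [e1, integral_const_mul, gibbs_clm_mul_clm_drift ω₂ 0 0 γ hω le_rfl le_rfl T hT (N + 1) L,
      sum_bathWeight_mul_sq]
    obtain ⟨hr, ha⟩ := harmonic_pairCorr_endAutocorr_eq hω hγ hT N t
    rw [hr, ha, hL, hL]
    field_simp
    ring
  rw [hint] at hD
  exact hD

/-- **The forecast norm is continuous in time at the harmonic corner** (on all of `ℝ`; it is the constant `T` on
`(-∞, 0]`). [folklore] -/
theorem harmonic_fnorm_continuous (N : ℕ) : Continuous fun s => fnorm ω₂ 0 0 γ T N s := by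
  have hfun : (fun s => fnorm ω₂ 0 0 γ T N s) =
      fun s => ∫ z, (((pinnedChain ω₂ 0 0 γ).chainFlow (N + 1) z 0 s).2 (Fin.last N)) ^ 2
        ∂((pinnedChain ω₂ 0 0 γ).gibbsMeasure (N + 1) T) :=
    funext fun s => harmonic_fnorm_eq_integral_freeFlow hω hγ hT N s
  rw [hfun]
  exact (harmonic_freeFlow_sqMomentum_hasDerivAt ω₂ γ hω hγ T hT (N + 1) (Fin.last N)).1

/-! ### Continuity of the responses; the integrated (tail) identity -/

omit hT in
/-- The free-flow coordinates are continuous in time. [folklore] -/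
theorem harmonic_continuous_freeFlow_snd (n : ℕ) (x : PhaseSpace n) (i : Fin n) :
    Continuous fun s => ((pinnedChain ω₂ 0 0 γ).chainFlow n x 0 s).2 i :=
  (continuous_apply i).comp (continuous_snd.comp
    (pinnedChain_continuous_chainFlow hω le_rfl le_rfl hγ.le n x (η := 0) continuous_zero))

/-- `t ↦ r_N(t)` is continuous at the harmonic corner. [folklore] -/
theorem harmonic_pairCorr_continuous (N : ℕ) : Continuous fun s => pairCorr ω₂ 0 0 γ T N s := by
  have e : (fun s => pairCorr ω₂ 0 0 γ T N s) = fun s => T * ((pinnedChain ω₂ 0 0 γ).chainFlow (N + 1)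
      ((0, Pi.single 0 1) : PhaseSpace (N + 1)) 0 s).2 (Fin.last N) :=
    funext fun s => (harmonic_pairCorr_endAutocorr_eq hω hγ hT N s).1
  rw [e]
  exact continuous_const.mul (harmonic_continuous_freeFlow_snd hω hγ (N + 1) _ _)

/-- `t ↦ a_N(t) = ⟨p_N, K_t p_N⟩_{μ₀}` is continuous at the harmonic corner. [folklore] -/
theorem harmonic_endAutocorr_continuous (N : ℕ) :
    Continuous fun s => ∫ z, z.2 (Fin.last N) * fcast ω₂ 0 0 γ T N s z ∂((pinnedChain ω₂ 0 0 γ).gibbsMeasure (N + 1) T) := by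
  have e : (fun s => ∫ z, z.2 (Fin.last N) * fcast ω₂ 0 0 γ T N s z ∂((pinnedChain ω₂ 0 0 γ).gibbsMeasure (N + 1) T)) =
      fun s => T * ((pinnedChain ω₂ 0 0 γ).chainFlow (N + 1)
        ((0, Pi.single (Fin.last N) 1) : PhaseSpace (N + 1)) 0 s).2 (Fin.last N) :=
    funext fun s => (harmonic_pairCorr_endAutocorr_eq hω hγ hT N s).2
  rw [e]
  exact continuous_const.mul (harmonic_continuous_freeFlow_snd hω hγ (N + 1) _ _)

/-- **THE HARMONIC TAIL IDENTITY**: `S_N(t₁) - S_N(t₂) = (2γ/T) ∫_{t₁}^{t₂} (r_N² + a_N²)` for `0 ≤ t₁ ≤ t₂` — the forecast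
norm lost between two times is EXACTLY the coherent budget spent in between (fundamental theorem of calculus on the
dissipation identity). [folklore] -/
theorem harmonic_fnorm_sub_eq_integral (N : ℕ) {t₁ t₂ : ℝ} (h0 : 0 ≤ t₁) (h12 : t₁ ≤ t₂) :
    fnorm ω₂ 0 0 γ T N t₁ - fnorm ω₂ 0 0 γ T N t₂ =
      (2 * γ / T) * ∫ s in t₁..t₂, ((pairCorr ω₂ 0 0 γ T N s) ^ 2 +
        (∫ z, z.2 (Fin.last N) * fcast ω₂ 0 0 γ T N s z ∂((pinnedChain ω₂ 0 0 γ).gibbsMeasure (N + 1) T)) ^ 2) := by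
  have hgc : Continuous fun s => (pairCorr ω₂ 0 0 γ T N s) ^ 2 +
      (∫ z, z.2 (Fin.last N) * fcast ω₂ 0 0 γ T N s z ∂((pinnedChain ω₂ 0 0 γ).gibbsMeasure (N + 1) T)) ^ 2 :=
    ((harmonic_pairCorr_continuous hω hγ hT N).pow 2).add ((harmonic_endAutocorr_continuous hω hγ hT N).pow 2)
  have key := intervalIntegral.integral_eq_sub_of_hasDerivAt_of_le h12
    ((harmonic_fnorm_continuous hω hγ hT N).continuousOn)
    (fun s hs => harmonic_fnorm_hasDerivAt hω hγ hT N (h0.trans_lt hs.1))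
    ((continuous_const.mul hgc).intervalIntegrable _ _)
  rw [intervalIntegral.integral_const_mul] at key
  linarith

omit hω hγ hT in
/-- **Registered closed form (`harmonic_fnorm_dissipation`): the exact dissipation identity of the forecast norm at the
harmonic corner.** For `ω₂, γ, T > 0`, every `N` and `t > 0`:
`dS_N/dt = -(2γ/T)·(r_N(t)² + a_N(t)²)`, with `a_N(t) = ⟨p_N, K_t p_N⟩_{μ₀}` written out. [folklore] -/
theorem harmonic_fnorm_dissipation : ∀ ω₂ γ : ℝ, 0 < ω₂ → 0 < γ → ∀ T : ℝ, 0 < T → ∀ (N : ℕ) (t : ℝ), 0 < t → HasDerivAt (fun s => fnorm ω₂ 0 0 γ T N s) (-(2 * γ / T) * ((pairCorr ω₂ 0 0 γ T N t) ^ 2 + (∫ z, z.2 (Fin.last N) * fcast ω₂ 0 0 γ T N t z ∂((pinnedChain ω₂ 0 0 γ).gibbsMeasure (N + 1) T)) ^ 2)) t :=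
  fun _ _ hω hγ _ hT N _ ht => harmonic_fnorm_hasDerivAt hω hγ hT N ht

end Harmonic

end Summit.AtomisticToContinuum.FouriersLaw.Theorems.PhononMeanFreePath

end
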